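import Summits.Ventures.HSemireg.WedgeHankelRecurrenceGaussChebyshevDifferentialEquation

/-!
# Venture HSemireg — **THE CLEBSCH–GORDAN RULE FOR THE VIETA–FIBONACCI POLYNOMIALS: `S_m · S_n = Σ_{k=0}^{n} S_{m−n+2k}` for all `m ∈ ℤ`, `n ∈ ℕ`, in every commutative ring** (at `X = q + q⁻¹`,
# `S_n` is the character of the `(n+1)`-dimensional representation of `SL₂`, and the identity is `V_m ⊗ V_n ≅ ⊕_k V_{m−n+2k}`; equivalently the linearisation formula of the Chebyshev
# polynomials of the second kind `U_m U_n = Σ_{k=0}^{n} U_{m−n+2k}`), with `S_n² = Σ_{k=0}^{n} S_{2k}`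

HONEST FRAMING. Part of the Lean index of the computation cell `pub-hsemireg` (seat p10 gen 49, Sunday typer «UNIFORM-IN-n»).  Polynomial algebra over a commutative ring (Mathlib
`Polynomial.Chebyshev.S`, `Finset.sum`); no variety, no cohomology theory, no sheaf, no Ext group and no semiregularity map is constructed here; nothing here says that HC / HC_CM / HC_AV holds;
no Literature fact (unproved `Prop`) is declared or used.  Custodian versions as in `WedgeHankelSiegelIdeal` (1/3).
SOURCES (cited).  J. C. Mason, D. C. Handscomb, *Chebyshev Polynomials* (2003), §2.4.3, (2.40) (`U_m U_n = Σ_{k=0}^{n} U_{m−n+2k}`, `m ≥ n`); W. Fulton, J. Harris, *Representation Theory* (Springer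
1991), Exercise 11.11 (Clebsch–Gordan for `sl₂`); T. J. Rivlin, *The Chebyshev Polynomials* (Wiley 1974), Ex. 1.5.x.
PROOF TYPED HERE.  Two-step induction on `n`: `S_m S_0 = S_m`, `S_m S_1 = X S_m = S_{m−1} + S_{m+1}` (Mathlib `S_sub_one`), and `S_m S_{n+2} = X·(S_m S_{n+1}) − S_m S_n` with
`X·S_j = S_{j+1} + S_{j−1}` applied termwise (`Finset.mul_sum`, `Finset.sum_add_distrib`, `Finset.sum_range_succ`); negative indices are covered by Mathlib's `S_{−k−2} = −S_k` convention, so no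
hypothesis `m ≥ n` is needed.
DEDUP DISCLOSURE (`rg -n 'S_mul_S|U_mul_U|∑ k ∈ Finset.range .*Chebyshev.(S|U)' Summits Literature Mathlib…Chebyshev.lean`, 2026-09-04): Mathlib has `T_mul_T`, `C_mul_C` (two-term product rules) and the
chapter `chebyshevC_mul_S` (§1246), `chebyshevT_mul_U` (§1203); the `n+1`-term linearisation of `S_m S_n` (`U_m U_n`) is not typed; 0 hits for the 3 names below.

WHAT IS IN THE TREE.  Mathlib `S_zero ∕ S_one ∕ S_add_two ∕ S_sub_one`, `Finset.mul_sum`, `Finset.sum_add_distrib`, `Finset.sum_range_succ`, `Nat.twoStepInduction`.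
THIS FILE (namespace `Summit.Ventures.HSemireg.Wedge.HankelOuter` continued; CHAINED on N536; 0 definitions):
* §1302 `X_mul_chebyshevS` (`X·S_j = S_{j+1} + S_{j−1}`), **`chebyshevS_mul_S`** (`S_m S_n = Σ_{k≤n} S_{m−n+2k}`, `m ∈ ℤ`, `n ∈ ℕ`), **`chebyshevS_sq_eq_sum`** (`S_n² = Σ_{k≤n} S_{2k}`).
CAVEATS.  Indices in `ℤ`; for `m < n` the formula stays valid with Mathlib's negative-index `S`.  Nothing Ext-side.  New names only.
-/

open Module Polynomial
open scoped Matrix Polynomial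

namespace Summit.Ventures.HSemireg.Wedge.HankelOuter

/-! ## §1302. `S_m S_n = Σ_{k=0}^{n} S_{m−n+2k}` -/

/-- `X·S_j = S_{j+1} + S_{j−1}` (the three-term recurrence, Mathlib `S_sub_one`). [this file, §1302] -/
theorem X_mul_chebyshevS (R : Type*) [CommRing R] (j : ℤ) :
    X * Polynomial.Chebyshev.S R j = Polynomial.Chebyshev.S R (j + 1) + Polynomial.Chebyshev.S R (j - 1) := by
  have h := Polynomial.Chebyshev.S_sub_one R j
  linear_combination -h

/-- **Clebsch–Gordan ∕ linearisation: `S_m · S_n = Σ_{k=0}^{n} S_{m−n+2k}`** for all `m ∈ ℤ`, `n ∈ ℕ`, in every commutative ring. [Mason–Handscomb 2003, (2.40); Fulton–Harris Ex. 11.11; this file, §1302] -/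
theorem chebyshevS_mul_S (R : Type*) [CommRing R] (m : ℤ) (n : ℕ) :
    Polynomial.Chebyshev.S R m * Polynomial.Chebyshev.S R (n : ℤ) = ∑ k ∈ Finset.range (n + 1), Polynomial.Chebyshev.S R (m - (n : ℤ) + 2 * (k : ℤ)) := by
  induction n using Nat.twoStepInduction with
  | zero => simp
  | one =>
    rw [Finset.sum_range_succ, Finset.sum_range_one]
    push_cast
    rw [show m - 1 + 0 = m - 1 by ring, show m - 1 + 2 = m + 1 by ring, Polynomial.Chebyshev.S_one, mul_comm, X_mul_chebyshevS]
    ring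
  | more n ih0 ih1 =>
    have hrec : Polynomial.Chebyshev.S R ((n + 2 : ℕ) : ℤ) = X * Polynomial.Chebyshev.S R ((n + 1 : ℕ) : ℤ) - Polynomial.Chebyshev.S R (n : ℤ) := by
      rw [show ((n + 2 : ℕ) : ℤ) = (n : ℤ) + 2 by push_cast; ring, Polynomial.Chebyshev.S_add_two, show (n : ℤ) + 1 = ((n + 1 : ℕ) : ℤ) by push_cast; ring]
    have key : ∀ k : ℕ, X * Polynomial.Chebyshev.S R (m - ((n + 1 : ℕ) : ℤ) + 2 * (k : ℤ)) =
        Polynomial.Chebyshev.S R (m - (n : ℤ) + 2 * (k : ℤ)) + Polynomial.Chebyshev.S R (m - ((n + 2 : ℕ) : ℤ) + 2 * (k : ℤ)) := fun k => by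
      rw [X_mul_chebyshevS, show m - ((n + 1 : ℕ) : ℤ) + 2 * (k : ℤ) + 1 = m - (n : ℤ) + 2 * (k : ℤ) by push_cast; ring,
        show m - ((n + 1 : ℕ) : ℤ) + 2 * (k : ℤ) - 1 = m - ((n + 2 : ℕ) : ℤ) + 2 * (k : ℤ) by push_cast; ring]
    have e1 : Polynomial.Chebyshev.S R m * (X * Polynomial.Chebyshev.S R ((n + 1 : ℕ) : ℤ) - Polynomial.Chebyshev.S R (n : ℤ)) =
        X * (Polynomial.Chebyshev.S R m * Polynomial.Chebyshev.S R ((n + 1 : ℕ) : ℤ)) - Polynomial.Chebyshev.S R m * Polynomial.Chebyshev.S R (n : ℤ) := by ring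
    rw [hrec, e1, ih1, ih0, Finset.mul_sum, Finset.sum_congr rfl fun k _ => key k, Finset.sum_add_distrib,
      Finset.sum_range_succ (fun k => Polynomial.Chebyshev.S R (m - (n : ℤ) + 2 * (k : ℤ))) (n + 1), show n + 1 + 1 = n + 2 from rfl,
      Finset.sum_range_succ (fun k => Polynomial.Chebyshev.S R (m - ((n + 2 : ℕ) : ℤ) + 2 * (k : ℤ))) (n + 2),
      show m - (n : ℤ) + 2 * ((n + 1 : ℕ) : ℤ) = m + n + 2 by push_cast; ring, show m - ((n + 2 : ℕ) : ℤ) + 2 * ((n + 2 : ℕ) : ℤ) = m + n + 2 by push_cast; ring]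
    ring

/-- **`S_n² = Σ_{k=0}^{n} S_{2k}`** in every commutative ring (`m = n`). [Mason–Handscomb 2003, (2.40); this file, §1302] -/
theorem chebyshevS_sq_eq_sum (R : Type*) [CommRing R] (n : ℕ) :
    Polynomial.Chebyshev.S R (n : ℤ) ^ 2 = ∑ k ∈ Finset.range (n + 1), Polynomial.Chebyshev.S R (2 * (k : ℤ)) := by
  rw [sq, chebyshevS_mul_S]
  exact Finset.sum_congr rfl fun k _ => by rw [sub_self, zero_add]

end Summit.Ventures.HSemireg.Wedge.HankelOuter
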